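/-
Copyright: statement-level skeleton of a published paper (lit-balaban cell, Phase-2 proof seat p25, gen 14). No proof
claims beyond what the kernel checks below.
-/
import Literature.MathematicalPhysics.QuantumFieldTheory.BalabanImbrieJaffe1984to88.BIJ88IbpComponents312

/-!
# `BalabanImbrieJaffe1984to88.BIJ88ConnectedDiagrams312` — T. Bałaban, J. Imbrie, A. Jaffe, *Effective action and cluster
properties of the abelian Higgs model*, Commun. Math. Phys. **114** (1988) 257–315 [BalabanImbrieJaffe1988], §5.14
p. 311–312 [PDF 55–56]: *"Each term is connected (see Sect. 3) … Summing all possible diagrams in X_c gives the observable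
for the next step there, F^L_{k+1,loc}(X_c)"* — **THE CONNECTED DIAGRAMS**: the complete contraction of a group of
observables decomposes over the partitions of the group into CONNECTED groups, and the connected sum is the truncated
(Ursell) part — so that the factor `F^L(X_c) := ursellOf wickSum X_c` of `BIJ88IbpComponents312.ibp_components_display`
IS the sum of all connected contraction diagrams of the observables of `X_c` (the linked-cluster theorem for Gaussian
contractions relative to a grouping of the legs into observables).

statement-level skeleton of published theorems with citation tags; proofs where landed; nothing here is a claim
about the Yang–Mills mass gap

PDF held: `paper:balaban1988-cmp114-bij-abelian-higgs-effective-action` (journal page = PDF page + 256); p. 312 = PDF 56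
(`p0056.txt` L1–L4).

CITATION HEADER (lean-in-tree rule).  lit-balaban cell, Phase 2, seat p25 gen 14; row **C2.Claim@312** of
`HOME/lit-balaban-r16/ROWS-C2-part2.md` (owner r16, referee ref-5), sequel of `BIJ88IbpComponents312` (same seat and
generation): its HONEST SCOPE item (c) — *"`F^L(X_c)` is the connected part defined by Möbius inversion; its
identification with a sum over connected contraction patterns is not restated"* — is DISCHARGED here.

THE MODEL (as in `BIJ88IbpComponents312`).  Legs `i` with owners `own i ∈ O`; a small partition `π` of the legs of a
group `V` of observables (pairs = covariance contractions, singletons = ℱ-trains); `π` SPLITS along `S ⊆ V` if no block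
joins `S` to `V∖S` (`BIJ88IbpComponents312.Splits`).  `π` is CONNECTED on `V` if `V` has no nonempty proper split subset;
the COMPONENT of `σ ∈ V` is the intersection of the split subsets containing `σ`.

## What is proved (0 `sorry`, standard axioms, no new `Prop` facts; definitions with bodies `atom`, `IsConn`, `comps`,
`res`, `connSum`)

* §1 `atom V π σ` (the component of `σ`), `mem_atom`, `self_mem_atom`, `atom_subset_of_splits` (minimality),
  `splits_compl` (complements of split sets are split), **`splits_atom`** (components are split off),
  **`atom_eq_of_mem`** (components are equal or disjoint), `IsConn` (+ decidability), `comps V π` (the set of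
  components) with **`isSetPartition_comps`**, `res π c` (the blocks inside the legs of `c`), **`isConn_res_atom`**
  (a component is connected), `res_mem_smallParts` (the blocks inside a split group partition its legs),
  `biUnion_res_comps` (a small partition is the union of its restrictions to its components);
  **`reach_eq_biUnion_atom`** — the remainder region `reach` of `BIJ88IbpComponents312` IS the union of the components of the
  owners of the legs contracted into the smooth factor (print's definition of the remainder components, verbatim).
* §2 **`sum_smallParts_eq_sum_comps`** — THE LINKED-CLUSTER BIJECTION: `Σ_{π∈smallParts(legs V)} g π =
  Σ_{P∈setPartitions V} Σ_{(π_c)_{c∈P}, π_c ∈ smallParts(legs c) connected on c} g(⋃_c π_c)` (fibrewise over the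
  component partition; per fibre the bijection `π ↦ (π|_c)_c`, inverse the union — `comps_biUnion` identifies the
  components of a union of connected pieces).
* §3 ON THE GAUSSIAN WEIGHTS: `connSum c := Σ_{π∈smallParts(legs c), connected} Π_{B∈π} w_B`;
  **`wickSum_eq_sum_setPartitions_connSum`** — `wickSum V = Σ_{P∈setPartitions V} Π_{c∈P} connSum c` (multiplicativity
  over the disjoint pieces, `Finset.prod_sum`); **`connSum_eq_ursellOf`** — `connSum c = ursellOf wickSum c` for
  nonempty `c` (uniqueness of Möbius inversion, `LatticeModels.eq_ursellOf_of_forall`): the `F^L(X_c)` of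
  `ibp_components_display` IS *"all possible [connected] diagrams in X_c"* summed; **`ibp_components_display_conn`** —
  the p. 312 first display with `Π_c F^L(X_c) = Π_c connSum(X_c)`.
HONEST SCOPE.  Pure finite combinatorics of contraction patterns + the two identities on the Gaussian model; connectedness
is relative to the grouping of legs into observables (two legs of one observable are connected through the observable),
which is print's *"connected component of X"* at the level of observables (the cube geometry `X = ∪ cubes` is not
modelled: an observable stands for its localization `X_{σ}`).  Nothing about which diagrams are *"the observable for the
next step"* beyond this identification; no estimates.  NOT summit progress; NOT continuum; NOT Clay.  Imports
`BIJ88IbpComponents312` only; modifies nothing.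
-/

noncomputable section

namespace Literature.MathematicalPhysics.QuantumFieldTheory.BalabanImbrieJaffe1984to88.BIJ88ConnectedDiagrams312

open MeasureTheory Matrix Finset Function
open scoped BigOperators ContDiff
open Literature.Probability.LatticeModels (setPartitions IsSetPartition mem_setPartitions setPartitions_empty
  ursellOf sum_setPartitions_prod_ursellOf eq_ursellOf_of_forall)
open Literature.MathematicalPhysics.QuantumFieldTheory.Balaban1983to89
open B2Eq228Conditioning (weight source)
open BIJ88PairingAllOrders5133 (smallParts smallParts_empty mem_smallParts)
open BIJ88WickSource305 (cweight)
open BIJ88IbpComponents312 (legs mem_legs legs_subset legs_mono disjoint_legs legs_inter Splits reach mem_reach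
  reach_subset_of_splits splits_reach wickSum remSum ibp_components_display)

variable {κ : Type} [LinearOrder κ] {O : Type} [DecidableEq O]

/-! ## §1  Components of a contraction pattern relative to the grouping into observables -/

section Atoms

variable (T : Finset κ) (own : κ → O)

/-- **The component of the observable `σ`** in the group `V` under the contraction pattern `π`: the observables lying
in every split subset of `V` containing `σ` (*"A connected component of X"*). [cite: BalabanImbrieJaffe1988, §5.14 p.311] -/
def atom (V : Finset O) (π : Finset (Finset κ)) (σ : O) : Finset O :=
  V.filter fun τ => ∀ S ∈ V.powerset, σ ∈ S → Splits T own π S → τ ∈ S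

/-- **Connected contraction pattern** on the group `V`: no nonempty proper subset of `V` is split off (*"Each term is
connected"*). [cite: BalabanImbrieJaffe1988, §5.14 p.311] -/
def IsConn (V : Finset O) (π : Finset (Finset κ)) : Prop :=
  ∀ S ∈ V.powerset, S.Nonempty → Splits T own π S → S = V

/-- decidability of `IsConn`. [cite: BalabanImbrieJaffe1988, §5.14 p.311] -/
instance instDecidableIsConn (V : Finset O) (π : Finset (Finset κ)) : Decidable (IsConn T own V π) := by
  unfold IsConn
  infer_instance

/-- **The components** of the group `V` under `π` (*"We break up the observable according to the connected components"*).
[cite: BalabanImbrieJaffe1988, §5.14 p.311] -/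
def comps (V : Finset O) (π : Finset (Finset κ)) : Finset (Finset O) := V.image (atom T own V π)

/-- The blocks of `π` inside the legs of the group `c` (the contraction pattern restricted to a component).
[cite: BalabanImbrieJaffe1988, §5.14 p.311] -/
def res (π : Finset (Finset κ)) (c : Finset O) : Finset (Finset κ) := π.filter fun B => B ⊆ legs T own c

variable {T own}

/-- membership in `atom`. [cite: BalabanImbrieJaffe1988, §5.14 p.311] -/
theorem mem_atom {V : Finset O} {π : Finset (Finset κ)} {σ τ : O} :
    τ ∈ atom T own V π σ ↔ τ ∈ V ∧ ∀ S, S ⊆ V → σ ∈ S → Splits T own π S → τ ∈ S := by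
  rw [atom, mem_filter]
  simp only [mem_powerset]

/-- `atom V π σ ⊆ V`. [cite: BalabanImbrieJaffe1988, §5.14 p.311] -/
theorem atom_subset (V : Finset O) (π : Finset (Finset κ)) (σ : O) : atom T own V π σ ⊆ V := filter_subset _ _

/-- `σ ∈ atom V π σ` for `σ ∈ V`. [cite: BalabanImbrieJaffe1988, §5.14 p.311] -/
theorem self_mem_atom {V : Finset O} (π : Finset (Finset κ)) {σ : O} (hσ : σ ∈ V) : σ ∈ atom T own V π σ :=
  mem_atom.2 ⟨hσ, fun _ _ h _ => h⟩

/-- **Minimality**: the component of `σ` is contained in every split subset containing `σ`.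
[cite: BalabanImbrieJaffe1988, §5.14 p.311] -/
theorem atom_subset_of_splits {V : Finset O} {π : Finset (Finset κ)} {σ : O} {S : Finset O} (hS : S ⊆ V)
    (hσS : σ ∈ S) (hsp : Splits T own π S) : atom T own V π σ ⊆ S := fun _ hτ =>
  (mem_atom.1 hτ).2 S hS hσS hsp

omit [LinearOrder κ] in
/-- The complement (in `V`) of a split subset is split, when all blocks lie in the legs of `V`.
[cite: BalabanImbrieJaffe1988, §5.14 p.311] -/
theorem splits_compl {V : Finset O} {π : Finset (Finset κ)} (hπ : ∀ B ∈ π, B ⊆ legs T own V) (S : Finset O)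
    (hsp : Splits T own π S) : Splits T own π (V \ S) := by
  intro B hB
  rcases hsp B hB with h | h
  · exact Or.inr ((disjoint_legs T own disjoint_sdiff).mono_left h)
  · refine Or.inl fun i hi => ?_
    have hiV := (mem_legs T own).1 (hπ B hB hi)
    refine (mem_legs T own).2 ⟨hiV.1, mem_sdiff.2 ⟨hiV.2, fun hiS => ?_⟩⟩
    exact disjoint_left.1 h hi ((mem_legs T own).2 ⟨hiV.1, hiS⟩)

/-- **Components are split off**: no block joins the component of `σ` to its complement.
[cite: BalabanImbrieJaffe1988, §5.14 p.311] -/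
theorem splits_atom {V : Finset O} {π : Finset (Finset κ)} (hπ : ∀ B ∈ π, B ⊆ legs T own V) (σ : O) :
    Splits T own π (atom T own V π σ) := by
  intro B hB
  by_cases h : B ⊆ legs T own (atom T own V π σ)
  · exact Or.inl h
  · refine Or.inr (disjoint_left.2 fun i hiB hil => ?_)
    obtain ⟨j, hjB, hjl⟩ := not_subset.1 h
    have hjV := (mem_legs T own).1 (hπ B hB hjB)
    have hj : own j ∉ atom T own V π σ := fun h' => hjl ((mem_legs T own).2 ⟨hjV.1, h'⟩)
    rw [mem_atom] at hj
    simp only [not_and, not_forall, exists_prop] at hj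
    obtain ⟨S, hSV, hσS, hsp, hjS⟩ := hj hjV.2
    have hi : own i ∈ S := (mem_atom.1 ((mem_legs T own).1 hil).2).2 S hSV hσS hsp
    rcases hsp B hB with hBS | hBS
    · exact hjS ((mem_legs T own).1 (hBS hjB)).2
    · exact disjoint_left.1 hBS hiB ((mem_legs T own).2 ⟨((mem_legs T own).1 hil).1, hi⟩)

/-- **Components are equal or disjoint**: if `τ` lies in the component of `σ`, the two components coincide.
[cite: BalabanImbrieJaffe1988, §5.14 p.311] -/
theorem atom_eq_of_mem {V : Finset O} {π : Finset (Finset κ)} (hπ : ∀ B ∈ π, B ⊆ legs T own V) {σ τ : O}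
    (hσ : σ ∈ V) (hτ : τ ∈ atom T own V π σ) : atom T own V π τ = atom T own V π σ := by
  apply Subset.antisymm
  · exact atom_subset_of_splits (atom_subset V π σ) hτ (splits_atom hπ σ)
  · have hστ : σ ∈ atom T own V π τ := by
      refine mem_atom.2 ⟨hσ, fun S hS hτS hsp => ?_⟩
      by_contra hσS
      have h := atom_subset_of_splits (sdiff_subset (t := S)) (mem_sdiff.2 ⟨hσ, hσS⟩) (splits_compl hπ S hsp) hτ
      exact (mem_sdiff.1 h).2 hτS
    exact atom_subset_of_splits (atom_subset V π τ) hστ (splits_atom hπ τ)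

/-- **The components form a set partition of the group.** [cite: BalabanImbrieJaffe1988, §5.14 p.311] -/
theorem isSetPartition_comps {V : Finset O} {π : Finset (Finset κ)} (hπ : ∀ B ∈ π, B ⊆ legs T own V) :
    IsSetPartition V (comps T own V π) := by
  refine ⟨fun P hP => ?_, fun he => ?_, fun v hv => ⟨_, mem_image_of_mem _ hv, self_mem_atom π hv⟩,
    fun P hP Q hQ v hvP hvQ => ?_⟩
  · obtain ⟨σ, -, rfl⟩ := mem_image.1 hP
    exact atom_subset V π σ
  · obtain ⟨σ, hσ, he⟩ := mem_image.1 he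
    exact (notMem_empty σ) (he ▸ self_mem_atom π hσ)
  · obtain ⟨σ, hσ, rfl⟩ := mem_image.1 hP
    obtain ⟨τ, hτ, rfl⟩ := mem_image.1 hQ
    rw [← atom_eq_of_mem hπ hσ hvP, atom_eq_of_mem hπ hτ hvQ]

/-- membership in `res`. [cite: BalabanImbrieJaffe1988, §5.14 p.311] -/
@[simp] theorem mem_res {π : Finset (Finset κ)} {c : Finset O} {B : Finset κ} :
    B ∈ res T own π c ↔ B ∈ π ∧ B ⊆ legs T own c := mem_filter

omit [LinearOrder κ] in
/-- A block meeting the legs of a split group lies inside them. [cite: BalabanImbrieJaffe1988, §5.14 p.311] -/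
theorem subset_legs_of_splits {π : Finset (Finset κ)} {S : Finset O} (hsp : Splits T own π S) {B : Finset κ}
    (hB : B ∈ π) {i : κ} (hiB : i ∈ B) (hiS : i ∈ legs T own S) : B ⊆ legs T own S := by
  rcases hsp B hB with h | h
  · exact h
  · exact absurd hiS (disjoint_left.1 h hiB)

/-- **The blocks inside a split group partition its legs** (into blocks of one or two legs).
[cite: BalabanImbrieJaffe1988, §5.14 p.311] -/
theorem res_mem_smallParts {V : Finset O} {π : Finset (Finset κ)} (hπ : π ∈ smallParts (legs T own V)) {c : Finset O}
    (hc : c ⊆ V) (hsp : Splits T own π c) : res T own π c ∈ smallParts (legs T own c) := by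
  obtain ⟨hP, hsm⟩ := mem_smallParts.1 hπ
  refine mem_smallParts.2 ⟨⟨fun B hB => (mem_res.1 hB).2, fun he => hP.2.1 (mem_res.1 he).1, fun i hi => ?_,
    fun B hB B' hB' i hiB hiB' => hP.eq_of_mem (mem_res.1 hB).1 (mem_res.1 hB').1 hiB hiB'⟩,
    fun B hB => hsm B (mem_res.1 hB).1⟩
  obtain ⟨B, hB, hiB⟩ := hP.exists_mem (legs_mono T own hc hi)
  exact ⟨B, mem_res.2 ⟨hB, subset_legs_of_splits hsp hB hiB hi⟩, hiB⟩

/-- **A component is connected** (for the restricted pattern). [cite: BalabanImbrieJaffe1988, §5.14 p.311] -/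
theorem isConn_res_atom {V : Finset O} {π : Finset (Finset κ)} (hπ : ∀ B ∈ π, B ⊆ legs T own V) {σ : O}
    (hσ : σ ∈ V) : IsConn T own (atom T own V π σ) (res T own π (atom T own V π σ)) := by
  intro S hS hSne hsp
  rw [mem_powerset] at hS
  -- `S` is split for the whole pattern
  have hsp' : Splits T own π S := by
    intro B hB
    rcases splits_atom hπ σ B hB with h | h
    · exact hsp B (mem_res.2 ⟨hB, h⟩)
    · exact Or.inr (h.mono_right (legs_mono T own hS))
  obtain ⟨v, hv⟩ := hSne
  apply Subset.antisymm hS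
  have h1 : atom T own V π v ⊆ S := atom_subset_of_splits (hS.trans (atom_subset V π σ)) hv hsp'
  rwa [atom_eq_of_mem hπ hσ (hS hv)] at h1

/-- **A contraction pattern is the union of its restrictions to its components.**
[cite: BalabanImbrieJaffe1988, §5.14 p.311] -/
theorem biUnion_res_comps {V : Finset O} {π : Finset (Finset κ)} (hπP : IsSetPartition (legs T own V) π) :
    (comps T own V π).biUnion (res T own π) = π := by
  have hπ : ∀ B ∈ π, B ⊆ legs T own V := fun B hB => hπP.subset hB
  ext B
  simp only [mem_biUnion, mem_res]
  constructor
  · rintro ⟨c, -, hB, -⟩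
    exact hB
  · intro hB
    obtain ⟨i, hi⟩ := hπP.nonempty_of_mem hB
    have hiV := (mem_legs T own).1 (hπ B hB hi)
    refine ⟨atom T own V π (own i), mem_image_of_mem _ hiV.2, hB, ?_⟩
    exact subset_legs_of_splits (splits_atom hπ (own i)) hB hi
      ((mem_legs T own).2 ⟨hiV.1, self_mem_atom π hiV.2⟩)

/-- **The components of a union of connected pieces.**  For a set partition `P` of `V` and connected small partitions
`f c` of the legs of each block `c ∈ P`, the component of `σ ∈ c₀ ∈ P` under `⋃_c f c` is `c₀`.
[cite: BalabanImbrieJaffe1988, §5.14 p.311] -/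
theorem atom_biUnion_eq {V : Finset O} {P : Finset (Finset O)} (hP : IsSetPartition V P)
    (f : ∀ c ∈ P, Finset (Finset κ)) (hf : ∀ c (hc : c ∈ P), f c hc ∈ smallParts (legs T own c))
    (hfc : ∀ c (hc : c ∈ P), IsConn T own c (f c hc)) {c₀ : Finset O} (hc₀ : c₀ ∈ P) {σ : O} (hσ : σ ∈ c₀) :
    atom T own V (P.attach.biUnion fun c => f c.1 c.2) σ = c₀ := by
  set π := P.attach.biUnion fun c => f c.1 c.2 with hπdef
  have hmemπ : ∀ {B}, B ∈ π ↔ ∃ c, ∃ hc : c ∈ P, B ∈ f c hc := by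
    intro B
    simp only [hπdef, mem_biUnion, mem_attach, true_and, Subtype.exists]
  have hπ : ∀ B ∈ π, B ⊆ legs T own V := fun B hB => by
    obtain ⟨c, hc, hBc⟩ := hmemπ.1 hB
    exact ((mem_smallParts.1 (hf c hc)).1.subset hBc).trans (legs_mono T own (hP.subset hc))
  -- every block of `P` is split for the union
  have hsplitP : ∀ c ∈ P, Splits T own π c := by
    intro c hc B hB
    obtain ⟨c', hc', hBc'⟩ := hmemπ.1 hB
    have hBl := (mem_smallParts.1 (hf c' hc')).1.subset hBc'
    by_cases h : c' = c
    · subst h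
      exact Or.inl hBl
    · exact Or.inr ((disjoint_legs T own (hP.disjoint hc' hc h)).mono_left hBl)
  apply Subset.antisymm (atom_subset_of_splits (hP.subset hc₀) hσ (hsplitP c₀ hc₀))
  -- the component of `σ` is split inside `c₀` for the connected piece `f c₀`, hence all of `c₀`
  have hA : atom T own V π σ ⊆ c₀ := atom_subset_of_splits (hP.subset hc₀) hσ (hsplitP c₀ hc₀)
  have hspA : Splits T own (f c₀ hc₀) (atom T own V π σ) := fun B hB =>
    splits_atom hπ σ B (hmemπ.2 ⟨c₀, hc₀, hB⟩)
  have := hfc c₀ hc₀ (atom T own V π σ) (mem_powerset.2 hA) ⟨σ, self_mem_atom π (hP.subset hc₀ hσ)⟩ hspA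
  exact this.symm.subset

/-- The components of a union of connected pieces over the set partition `P` are the blocks of `P`.
[cite: BalabanImbrieJaffe1988, §5.14 p.311] -/
theorem comps_biUnion_eq {V : Finset O} {P : Finset (Finset O)} (hP : IsSetPartition V P)
    (f : ∀ c ∈ P, Finset (Finset κ)) (hf : ∀ c (hc : c ∈ P), f c hc ∈ smallParts (legs T own c))
    (hfc : ∀ c (hc : c ∈ P), IsConn T own c (f c hc)) :
    comps T own V (P.attach.biUnion fun c => f c.1 c.2) = P := by
  ext c
  rw [comps, mem_image]
  constructor
  · rintro ⟨σ, hσ, rfl⟩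
    obtain ⟨c₀, hc₀, hσc₀⟩ := hP.exists_mem hσ
    rw [atom_biUnion_eq hP f hf hfc hc₀ hσc₀]
    exact hc₀
  · intro hc
    obtain ⟨σ, hσ⟩ := hP.nonempty_of_mem hc
    exact ⟨σ, hP.subset hc hσ, atom_biUnion_eq hP f hf hfc hc hσ⟩

/-- `legs (S ∪ S') = legs S ∪ legs S'`. [cite: BalabanImbrieJaffe1988, §5.14 p.311] -/
theorem legs_union (S S' : Finset O) : legs T own (S ∪ S') = legs T own S ∪ legs T own S' := by
  ext i
  simp only [mem_legs, mem_union]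
  tauto

/-- Split sets are closed under union. [cite: BalabanImbrieJaffe1988, §5.14 p.311] -/
theorem splits_union {π : Finset (Finset κ)} {S S' : Finset O} (hS : Splits T own π S) (hS' : Splits T own π S') :
    Splits T own π (S ∪ S') := by
  intro B hB
  rw [legs_union]
  rcases hS B hB with h | h
  · exact Or.inl (h.trans subset_union_left)
  · rcases hS' B hB with h' | h'
    · exact Or.inl (h'.trans subset_union_right)
    · exact Or.inr (disjoint_union_right.2 ⟨h, h'⟩)

/-- Split sets are closed under finite unions. [cite: BalabanImbrieJaffe1988, §5.14 p.311] -/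
theorem splits_biUnion {π : Finset (Finset κ)} {ι' : Type} (s : Finset ι') (S : ι' → Finset O)
    (h : ∀ x ∈ s, Splits T own π (S x)) : Splits T own π (s.biUnion S) := by
  classical
  induction s using Finset.induction_on with
  | empty =>
    intro B _
    exact Or.inr (by simp [legs])
  | insert a s ha ih =>
    rw [biUnion_insert]
    exact splits_union (h a (mem_insert_self a s)) (ih fun x hx => h x (mem_insert_of_mem hx))

/-- **The remainder region of `BIJ88IbpComponents312` IS the union of the components containing the owners of the legs
contracted into the smooth factor** (*"The components containing contractions to χ′ … are called remainder components
{X_r}"*, verbatim): for all owners present in `V` and blocks inside the legs of `V`,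
`reach V D π = ⋃_{i∈D} atom V π (own i)`. [cite: BalabanImbrieJaffe1988, §5.14 p.311] -/
theorem reach_eq_biUnion_atom {V : Finset O} (hV : ∀ i ∈ T, own i ∈ V) {π : Finset (Finset κ)}
    (hπ : ∀ B ∈ π, B ⊆ legs T own V) {D : Finset κ} (hD : D ⊆ T) :
    reach T own V D π = (D.image own).biUnion (atom T own V π) := by
  have hπT : ∀ B ∈ π, B ⊆ T := fun B hB => (hπ B hB).trans (legs_subset T own V)
  have hDV : D.image own ⊆ V := fun σ hσ => by
    obtain ⟨i, hi, rfl⟩ := mem_image.1 hσ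
    exact hV i (hD hi)
  apply Subset.antisymm
  · -- the union of the components is split and contains the owners of `D`
    refine reach_subset_of_splits (fun τ hτ => ?_) (fun σ hσ => ?_)
      (splits_biUnion _ _ fun σ _ => splits_atom hπ σ)
    · obtain ⟨σ, -, hτσ⟩ := mem_biUnion.1 hτ
      exact atom_subset V π σ hτσ
    · exact mem_biUnion.2 ⟨σ, hσ, self_mem_atom π (hDV hσ)⟩
  · -- each component of an owner of `D` lies in the (split) remainder region
    intro τ hτ
    obtain ⟨σ, hσ, hτσ⟩ := mem_biUnion.1 hτ
    have hsub : atom T own V π σ ⊆ reach T own V D π :=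
      atom_subset_of_splits (BIJ88IbpComponents312.reach_subset V D π)
        (BIJ88IbpComponents312.image_subset_reach hDV π hσ) (splits_reach hV hπT)
    exact hsub hτσ

end Atoms

/-! ## §2  The linked-cluster bijection -/

section Bijection

variable {T : Finset κ} {own : κ → O}

omit [DecidableEq O] in
/-- auxiliary: `biUnion` over `attach`. [folklore] [cite: BalabanImbrieJaffe1988, §5.14 p.311] -/
theorem biUnion_attach_eq (P : Finset (Finset O)) (r : Finset O → Finset (Finset κ)) :
    (P.attach.biUnion fun c => r c.1) = P.biUnion r := by
  ext B
  simp only [mem_biUnion, mem_attach, true_and, Subtype.exists, exists_prop]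

/-- **THE LINKED-CLUSTER BIJECTION**: a small partition of the legs of `V` is the same as its component partition
`P ∈ setPartitions V` together with a CONNECTED small partition of the legs of each component:
`Σ_{π∈smallParts(legs V)} g π = Σ_{P∈setPartitions V} Σ_{f∈Π_{c∈P}{connected small partitions of legs c}} g(⋃_c f c)`.
[cite: BalabanImbrieJaffe1988, §5.14 p.311–312] -/
theorem sum_smallParts_eq_sum_comps (V : Finset O) {M : Type*} [AddCommMonoid M] (g : Finset (Finset κ) → M) :
    ∑ π ∈ smallParts (legs T own V), g π
      = ∑ P ∈ setPartitions V,
          ∑ f ∈ P.pi (fun c => (smallParts (legs T own c)).filter (IsConn T own c)),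
            g (P.attach.biUnion fun c => f c.1 c.2) := by
  -- fibrewise over the component partition
  have hmaps : ∀ π ∈ smallParts (legs T own V), comps T own V π ∈ setPartitions V := fun π hπ =>
    mem_setPartitions.2 (isSetPartition_comps fun B hB => (mem_smallParts.1 hπ).1.subset hB)
  rw [← sum_fiberwise_of_maps_to hmaps]
  refine sum_congr rfl fun P hP => ?_
  have hPP : IsSetPartition V P := mem_setPartitions.1 hP
  -- per fibre: `π ↦ (π|_c)_c`, inverse the union
  refine sum_nbij' (fun π => fun c _ => res T own π c) (fun f => P.attach.biUnion fun c => f c.1 c.2) ?_ ?_ ?_ ?_ ?_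
  · -- well-defined
    intro π hπ
    obtain ⟨hπ, hcomp⟩ := mem_filter.1 hπ
    have hπl : ∀ B ∈ π, B ⊆ legs T own V := fun B hB => (mem_smallParts.1 hπ).1.subset hB
    refine mem_pi.2 fun c hc => mem_filter.2 ⟨?_, ?_⟩
    · rw [← hcomp] at hc
      obtain ⟨σ, -, rfl⟩ := mem_image.1 hc
      exact res_mem_smallParts hπ (atom_subset V π σ) (splits_atom hπl σ)
    · rw [← hcomp] at hc
      obtain ⟨σ, hσ, rfl⟩ := mem_image.1 hc
      exact isConn_res_atom hπl hσ
  · -- the inverse is well-defined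
    intro f hf
    have hf' : ∀ c (hc : c ∈ P), f c hc ∈ smallParts (legs T own c) := fun c hc =>
      (mem_filter.1 (mem_pi.1 hf c hc)).1
    have hfc : ∀ c (hc : c ∈ P), IsConn T own c (f c hc) := fun c hc => (mem_filter.1 (mem_pi.1 hf c hc)).2
    refine mem_filter.2 ⟨mem_smallParts.2 ⟨?_, ?_⟩, comps_biUnion_eq hPP f hf' hfc⟩
    · refine ⟨fun B hB => ?_, fun he => ?_, fun i hi => ?_, fun B hB B' hB' i hiB hiB' => ?_⟩
      · obtain ⟨c, -, hBc⟩ := mem_biUnion.1 hB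
        exact ((mem_smallParts.1 (hf' c.1 c.2)).1.subset hBc).trans (legs_mono T own (hPP.subset c.2))
      · obtain ⟨c, -, hBc⟩ := mem_biUnion.1 he
        exact (mem_smallParts.1 (hf' c.1 c.2)).1.2.1 hBc
      · obtain ⟨hiT, hiV⟩ := (mem_legs T own).1 hi
        obtain ⟨c, hc, hic⟩ := hPP.exists_mem hiV
        obtain ⟨B, hB, hiB⟩ := (mem_smallParts.1 (hf' c hc)).1.exists_mem ((mem_legs T own).2 ⟨hiT, hic⟩)
        exact ⟨B, mem_biUnion.2 ⟨⟨c, hc⟩, mem_attach _ _, hB⟩, hiB⟩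
      · obtain ⟨c, -, hBc⟩ := mem_biUnion.1 hB
        obtain ⟨c', -, hBc'⟩ := mem_biUnion.1 hB'
        have hic : own i ∈ c.1 := ((mem_legs T own).1 ((mem_smallParts.1 (hf' c.1 c.2)).1.subset hBc hiB)).2
        have hic' : own i ∈ c'.1 :=
          ((mem_legs T own).1 ((mem_smallParts.1 (hf' c'.1 c'.2)).1.subset hBc' hiB')).2
        have hcc : c.1 = c'.1 := hPP.eq_of_mem c.2 c'.2 hic hic'
        obtain ⟨c, hc⟩ := c
        obtain ⟨c', hc'⟩ := c'
        simp only at hcc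
        subst hcc
        exact (mem_smallParts.1 (hf' c hc)).1.eq_of_mem hBc hBc' hiB hiB'
    · intro B hB
      obtain ⟨c, -, hBc⟩ := mem_biUnion.1 hB
      exact (mem_smallParts.1 (hf' c.1 c.2)).2 B hBc
  · -- left inverse: the union of the restrictions is `π`
    intro π hπ
    obtain ⟨hπ, hcomp⟩ := mem_filter.1 hπ
    have h := biUnion_res_comps (T := T) (own := own) (mem_smallParts.1 hπ).1
    rw [hcomp] at h
    exact (biUnion_attach_eq P (res T own π)).trans h
  · -- right inverse: the restrictions of the union are the pieces
    intro f hf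
    have hf' : ∀ c (hc : c ∈ P), f c hc ∈ smallParts (legs T own c) := fun c hc =>
      (mem_filter.1 (mem_pi.1 hf c hc)).1
    funext c hc
    ext B
    simp only [mem_res, mem_biUnion, mem_attach, true_and, Subtype.exists]
    constructor
    · rintro ⟨⟨c', hc', hBc'⟩, hBl⟩
      by_cases h : c' = c
      · subst h
        exact hBc'
      · exfalso
        obtain ⟨i, hi⟩ := (mem_smallParts.1 (hf' c' hc')).1.nonempty_of_mem hBc'
        have h1 := (mem_smallParts.1 (hf' c' hc')).1.subset hBc' hi
        exact disjoint_left.1 (disjoint_legs T own (hPP.disjoint hc' hc h)) h1 (hBl hi)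
    · intro hB
      exact ⟨⟨c, hc, hB⟩, (mem_smallParts.1 (hf' c hc)).1.subset hB⟩
  · intro π hπ
    obtain ⟨hπ, hcomp⟩ := mem_filter.1 hπ
    have h := biUnion_res_comps (T := T) (own := own) (mem_smallParts.1 hπ).1
    rw [hcomp] at h
    show g π = g (P.attach.biUnion fun c => res T own π c.1)
    rw [biUnion_attach_eq, h]

end Bijection

/-! ## §3  On the Gaussian weights: connected diagrams are the Ursell part -/

section Gauss

variable {S : Type} [Fintype S] [DecidableEq S]

/-- **The sum of the CONNECTED contraction diagrams of the observables of `c`** (*"Summing all possible diagrams in X_c"*,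
each term being connected). [cite: BalabanImbrieJaffe1988, §5.14 p.312] -/
def connSum (A : Matrix S S ℝ) (f : S → ℝ) (v : κ → S → ℝ) (T : Finset κ) (own : κ → O) (c : Finset O) : ℝ :=
  ∑ π ∈ (smallParts (legs T own c)).filter (IsConn T own c), ∏ B ∈ π, cweight A f v B

/-- **The complete contraction decomposes over the partitions into connected groups**:
`wickSum V = Σ_{P∈setPartitions V} Π_{c∈P} connSum c`. [cite: BalabanImbrieJaffe1988, §5.14 p.312] -/
theorem wickSum_eq_sum_setPartitions_connSum (A : Matrix S S ℝ) (f : S → ℝ) (v : κ → S → ℝ) (T : Finset κ)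
    (own : κ → O) (V : Finset O) :
    wickSum A f v T own V = ∑ P ∈ setPartitions V, ∏ c ∈ P, connSum A f v T own c := by
  rw [wickSum, sum_smallParts_eq_sum_comps]
  refine sum_congr rfl fun P hP => ?_
  have hPP : IsSetPartition V P := mem_setPartitions.1 hP
  -- `Π_{c∈P} Σ_{π_c} = Σ_f Π_c` and multiplicativity of the weight over the disjoint pieces
  have hprod : ∏ c ∈ P, connSum A f v T own c
      = ∑ g ∈ P.pi (fun c => (smallParts (legs T own c)).filter (IsConn T own c)),
          ∏ c ∈ P.attach, ∏ B ∈ g c.1 c.2, cweight A f v B := by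
    simp only [connSum]
    rw [Finset.prod_sum]
  rw [hprod]
  refine sum_congr rfl fun g hg => ?_
  have hg' : ∀ c (hc : c ∈ P), g c hc ∈ smallParts (legs T own c) := fun c hc =>
    (mem_filter.1 (mem_pi.1 hg c hc)).1
  rw [prod_biUnion]
  intro c _ c' _ hne
  have hcc : c.1 ≠ c'.1 := fun h => hne (Subtype.ext h)
  exact (mem_smallParts.1 (hg' c.1 c.2)).1.disjoint_family (mem_smallParts.1 (hg' c'.1 c'.2)).1
    (disjoint_legs T own (hPP.disjoint c.2 c'.2 hcc))

/-- **`F^L(X_c)` IS THE SUM OF THE CONNECTED DIAGRAMS**: for a nonempty group `c`,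
`connSum c = ursellOf wickSum c` — the truncated part of the complete contraction (uniqueness of the Möbius inversion on
the partition lattice). [cite: BalabanImbrieJaffe1988, §5.14 p.312] -/
theorem connSum_eq_ursellOf (A : Matrix S S ℝ) (f : S → ℝ) (v : κ → S → ℝ) (T : Finset κ) (own : κ → O)
    {c : Finset O} (hc : c.Nonempty) :
    connSum A f v T own c = ursellOf (wickSum A f v T own) c :=
  eq_ursellOf_of_forall (wickSum A f v T own) (connSum A f v T own)
    (fun V _ => (wickSum_eq_sum_setPartitions_connSum A f v T own V).symm) hc

/-- A single observable is one component: all its contraction diagrams are connected, `connSum {σ} = wickSum {σ}`.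
[cite: BalabanImbrieJaffe1988, §5.14 p.312] -/
theorem connSum_singleton (A : Matrix S S ℝ) (f : S → ℝ) (v : κ → S → ℝ) (T : Finset κ) (own : κ → O) (σ : O) :
    connSum A f v T own {σ} = wickSum A f v T own {σ} := by
  rw [connSum_eq_ursellOf A f v T own (singleton_nonempty σ), Literature.Probability.LatticeModels.ursellOf_singleton]

/-- `Π_{c∈P} F^L(X_c) = Π_{c∈P} connSum c` over a set partition (all blocks nonempty).
[cite: BalabanImbrieJaffe1988, §5.14 p.312] -/
theorem prod_ursellOf_eq_prod_connSum (A : Matrix S S ℝ) (f : S → ℝ) (v : κ → S → ℝ) (T : Finset κ)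
    (own : κ → O) {V : Finset O} {P : Finset (Finset O)} (hP : P ∈ setPartitions V) :
    ∏ c ∈ P, ursellOf (wickSum A f v T own) c = ∏ c ∈ P, connSum A f v T own c :=
  prod_congr rfl fun _ hc => (connSum_eq_ursellOf A f v T own ((mem_setPartitions.1 hP).nonempty_of_mem hc)).symm

/-- **THE FIRST DISPLAY OF p. 312 WITH THE CONNECTED DIAGRAMS**: as `BIJ88IbpComponents312.ibp_components_display`, the
factor of the constant components now literally `Π_c (sum of the connected contraction diagrams of X_c)`:
`∫Π_σF_σ·H dμ/∫H dμ = Σ_{R⊆U} (Σ_{{X_c}∈setPartitions(U∖R)} Π_c connSum X_c)·(remSum R H/∫H dμ)`.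
[cite: BalabanImbrieJaffe1988, §5.14 p.312] -/
theorem ibp_components_display_conn (A : Matrix S S ℝ) (hA : A.PosDef) (f : S → ℝ) (v : κ → S → ℝ) {T : Finset κ}
    {own : κ → O} {U : Finset O} (hU : ∀ i ∈ T, own i ∈ U) {H : (S → ℝ) → ℝ} (hH : ContDiff ℝ ∞ H)
    (hb : ∀ k : ℕ, ∃ K : ℝ, ∀ φ : S → ℝ, ‖iteratedFDeriv ℝ k H φ‖ ≤ K) :
    (∫ φ : S → ℝ, (∏ σ ∈ U, ∏ i ∈ T with own i = σ, φ ⬝ᵥ v i) * H φ * (weight A φ * source f φ))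
        / ∫ φ : S → ℝ, H φ * (weight A φ * source f φ)
      = ∑ R ∈ U.powerset, (∑ P ∈ setPartitions (U \ R), ∏ c ∈ P, connSum A f v T own c) *
          (remSum A f v T own R H / ∫ φ : S → ℝ, H φ * (weight A φ * source f φ)) := by
  rw [ibp_components_display A hA f v hU hH hb]
  refine sum_congr rfl fun R _ => ?_
  rw [sum_congr rfl fun P hP => prod_ursellOf_eq_prod_connSum A f v T own hP]

end Gauss

end Literature.MathematicalPhysics.QuantumFieldTheory.BalabanImbrieJaffe1984to88.BIJ88ConnectedDiagrams312
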